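import Summits.Ventures.PercRepro.ProfilePointedCircuitClassesReplacementSingle

/-!
# PercRepro — THE IN–OUT INEQUALITY RELATIVE TO A FLAT AVOIDING THE POINT (the conjecture of record, NOT asserted)
(p5, gen 46; `proofs/P5-GM1.md` §68(f), ADDENDA 1 and 3)

`InOutFlatRelativeFour α` (a `Prop`; a CONJECTURE, NOT asserted): on every matroid with `#E = ρ + 4`, `ρ ≥ 6`, for
every point `e` and every flat `F` with `e ∉ F`, the bi-independent `4`-sets through `e` whose closure contains `F`
are at most the bi-independent `5`-sets avoiding `e` whose closure contains `F`:
`#{X ∈ BI_4 : e ∈ X, F ⊆ cl X} ≤ #{T ∈ BI_5 : e ∉ T, F ⊆ cl T}`.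
The case `F = ∅` is the `n = 10` theorem `InOutBottomFour` (`inOutBottomFour_of_inOutFlatRelativeFour`,
`inOutFlatRelative_empty`).  Why it matters: when the point `a'` of a series pair `{a, a'}` is placed freely on a
flat `F` of `N ／ a ∖ a'` avoiding `e` (a principal extension), the capture inequality (C) of TwelveCaptureB at `e`
is exactly this statement at `F` — with the uncaptured units to spare.  Census (kit j318941): 0 failures on
72,866,936 (matroid, flat, point) triples over all flats of rank `≤ 4` at nullities 2–4, equality attained at
`n = 10` for flats of rank 2 and 3.  The sets spanning a flat form a geometric up-set of the bi-independent poset;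
the census of §68 ADDENDUM 3 says every bottom-step inequality of the family (Theorem A's step, the point in–out,
the pair thru–thru and in–out) survives the restriction to such an up-set.
-/

open scoped Matroid

namespace PercRepro.Cogirth

open Finset ThmH Skew Shadow Profile

variable {α : Type} [DecidableEq α] {N : Matroid α} [N.Finite]

section FlatRelative

/-- **THE IN–OUT INEQUALITY RELATIVE TO A FLAT AVOIDING THE POINT** (a `Prop`; a CONJECTURE, NOT asserted; §68(f)):
on every matroid with `#E = ρ + 4`, `ρ ≥ 6`, every point `e` and every flat `F` (`cl F = F`) with `e ∉ F`,
`#{X ∈ BI_4 : e ∈ X ∧ F ⊆ cl X} ≤ #{T ∈ BI_5 : e ∉ T ∧ F ⊆ cl T}`.  `F = ∅` is `InOutBottomFour`. -/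
def InOutFlatRelativeFour (α : Type) [DecidableEq α] : Prop :=
  ∀ (N : Matroid α) [N.Finite] (e : α) (F : Finset α), e ∈ gr N → F ⊆ gr N → clF N F = F → e ∉ F →
    (gr N).card = rk N (gr N) + 4 → 6 ≤ rk N (gr N) →
    ((biIndepSets N 4).filter (fun X => e ∈ X ∧ F ⊆ clF N X)).card ≤
      ((biIndepSets N 5).filter (fun T => e ∉ T ∧ F ⊆ clF N T)).card

/-- The relative counts at `F = ∅` are the plain in / out counts. -/
theorem card_filter_empty_subset_clF_eq (k : ℕ) (e : α) :
    ((biIndepSets N k).filter (fun X => e ∈ X ∧ (∅ : Finset α) ⊆ clF N X)).card = inCount N k e ∧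
      ((biIndepSets N k).filter (fun X => e ∉ X ∧ (∅ : Finset α) ⊆ clF N X)).card = outCount N k e := by
  unfold inCount outCount
  constructor
  · apply congrArg
    apply filter_congr
    intro X _
    exact ⟨fun h => h.1, fun h => ⟨h, empty_subset _⟩⟩
  · apply congrArg
    apply filter_congr
    intro X _
    exact ⟨fun h => h.1, fun h => ⟨h, empty_subset _⟩⟩

/-- **THE CASE `F = ∅` IS THE `n = 10` THEOREM**: the relative inequality at the empty flat holds on every matroid
with `#E = ρ + 4`, `ρ ≥ 6` (`inOutBottomFour_holds`). -/
theorem inOutFlatRelative_empty (N : Matroid α) [N.Finite] (e : α) (he : e ∈ gr N)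
    (hn : (gr N).card = rk N (gr N) + 4) (hR : 6 ≤ rk N (gr N)) :
    ((biIndepSets N 4).filter (fun X => e ∈ X ∧ (∅ : Finset α) ⊆ clF N X)).card ≤
      ((biIndepSets N 5).filter (fun T => e ∉ T ∧ (∅ : Finset α) ⊆ clF N T)).card := by
  rw [(card_filter_empty_subset_clF_eq 4 e).1, (card_filter_empty_subset_clF_eq 5 e).2]
  exact inOutBottomFour_holds N e he hn hR

/-- The relative conjecture contains the `n = 10` theorem: `InOutFlatRelativeFour α → InOutBottomFour α`
(the empty flat; `clF N ∅ = ∅` holds on a loopless matroid, so the implication is stated for the loopless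
instance — the closure of `∅` is the set of loops). -/
theorem inCount_four_le_outCount_five_of_inOutFlatRelativeFour (hP : InOutFlatRelativeFour α)
    (N : Matroid α) [N.Finite] (hl : clF N (∅ : Finset α) = ∅) (e : α) (he : e ∈ gr N)
    (hn : (gr N).card = rk N (gr N) + 4) (hR : 6 ≤ rk N (gr N)) : inCount N 4 e ≤ outCount N 5 e := by
  have h := hP N e ∅ he (empty_subset _) hl (notMem_empty e) hn hR
  rwa [(card_filter_empty_subset_clF_eq 4 e).1, (card_filter_empty_subset_clF_eq 5 e).2] at h

end FlatRelative

end PercRepro.Cogirth
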